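import Literature.AlgebraicGeometry.Limits.LocalizationRelativeGroupSpread
import HarnessLib

/-!
# A group law on the generic fibre descends to a stage — DOCK for the assembly (SP1-e) `AbelianSchemeOverSpreadStage` (EGA IV₃ 8.8.2)

Topic `Literature/AlgebraicGeometry/Limits`; namespace `Literature.AlgebraicGeometry.Limits.LocApprox`.  THEOREMS ONLY (no definition, no instance, no notation, no
named fact, no `sorry`).  Cell `hodgecm-mathlib` (D-0151), FLOOR 0, P6 «MOD programme» (crux hLiu418 = stmt-HodgeConjecture-24832, `--supports`, count-neutral), SPREAD door,
organ (α) SP1 (d) FILE 3 of 3: the head **`exists_stage_grpObj_isPullback`** in EXACTLY the socket shape fixed by the (e) pen A-p06 (g31) (bus 2026-09-01 20:52:12Z; skeleton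
`AbelianSchemeOverSpreadStage.skeleton.v1` :49), over ★ FILE 1 `GroupLawTransferAlong` (fixed-stage transfer) and ★ FILE 2 `LocalizationRelativeGroupSpread`
(relative stages, the bridge, spreading of the structure maps).  HC_CM is proved only modulo the printed citations until rung 0 closes; nothing here is about HC.

THE STATEMENT.  `A` a domain, `K = Frac A` (`S = A ∖ 0`, so the legs `Spec K → D(s)` are schematically dominant — ★ `isSchemeTheoreticallyDominant_leg_left`), `P → Spec A`
quasi-compact quasi-separated with `P ⊗ D(t) → D(t)` FLAT (the consumer shrinks `t` first by generic flatness ★ `exists_forall_flat_snd`), `Y → P ⊗ D(t)` quasi-compact,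
quasi-separated, locally of finite presentation, FLAT and SEPARATED (the consumer calls this last, when `Y` is already smooth and proper), and `X → P ⊗ Spec K` a group
scheme which is the base change of `Y` along the leg (`IsPullback G X.hom Y.hom (P ◁ leg t).left`).  CONCLUSION: a finer stage `ρ : s ⟶ t`, a group-scheme structure on
`Yₛ := Y ×_{P ⊗ D(t)} (P ⊗ D(s))` over `P ⊗ D(s)`, and a comparison `Gₛ : X → Yₛ` over the leg at `s` which is cartesian, lies over `G` through the restriction `R : Yₛ → Y`,
and intertwines units and multiplications — the three clauses of ★ `AbelianSchemeOver.IsBaseChangeVia` (MFK Def. 7.2) for bare group objects.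

PROOF.  Transport the group structure of `X` to `Y_B := Y ×_{P_t} (P ⊗ Spec K)` along the canonical `X ≅ Y_B` (`GrpObj.ofIso`); spread the three structure maps to a common
stage (★ `exists_grpSpreadAlong`); at that stage the lifted maps form a group law (★ `GrpSpreadAlong.grpObj`: injectivity of base change along the schematically dominant
relative leg on morphisms from flat to separated schemes) for which `(Yₛ)_B ≅ Y_B` is a group isomorphism (★ `isMonHom_facObjIso_hom`); `Gₛ` is `X ≅ Y_B ≅ (Yₛ)_B → Yₛ`,
and the unit ∕ multiplication squares are the `IsMonHom` identities read on underlying schemes through Mathlib՚s `Over.ε_pullback_left`, `Over.μ_pullback_left_*`.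

## References
* [EGAIV3] A. Grothendieck, J. Dieudonné, *EGA IV₃*, Publ. Math. IHÉS 28 (1966), Thm. 8.8.2 (i)–(ii), 11.10.5.
* [StacksProject] The Stacks Project, Tags 01ZC, 01ZM.
* [MumfordFogartyKirwan1994] D. Mumford, J. Fogarty, F. Kirwan, *Geometric Invariant Theory*, 3rd ed. (1994), Ch. 7 §2 Definition 7.2 (p. 129).
* [GortzWedhorn2020] U. Görtz, T. Wedhorn, *Algebraic Geometry I*, 2nd ed. (2020), §(4.7), Prop. 4.16, Thm. 10.57, Cor. 10.64.
-/

set_option autoImplicit false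

noncomputable section

universe u

open CategoryTheory CategoryTheory.Limits AlgebraicGeometry MonoidalCategory CartesianMonoidalCategory MonObj
open Functor.LaxMonoidal Functor.OplaxMonoidal
open scoped CategoryTheory.Obj

namespace Literature.AlgebraicGeometry.Limits

/-! ## §1 Underlying-scheme readings of the factorisation isomorphism and of the monoidal structure of base change -/

namespace OverFac

set_option backward.isDefEq.respectTransparency false

variable {X : Scheme.{u}} {T G : Over X} (ℓ : G ⟶ T) (Y : Over X)

/-- `(Y_T)_G ≅ Y_G`, inverse, then the two first projections: the first projection of `Y_G`. [cite: GortzWedhorn2020, §(4.7) Prop. 4.16] -/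
@[reassoc]
theorem facObjIso_inv_left_fst_fst :
    (facObjIso ℓ Y).inv.left ≫ pullback.fst ((Over.pullback T.hom).obj Y).hom ℓ.left ≫ pullback.fst Y.hom T.hom = pullback.fst Y.hom G.hom := by
  rw [← pullbackFacObjIso_hom_left_fst T.hom ℓ.left G.hom (Over.w ℓ) Y, ← Over.comp_left_assoc, Iso.inv_hom_id, Over.id_left,
    Category.id_comp]

/-- `(Y_T)_G ≅ Y_G`, inverse, then the projection to `G`: the projection of `Y_G` to `G`. [cite: GortzWedhorn2020, §(4.7) Prop. 4.16] -/
@[reassoc]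
theorem facObjIso_inv_left_snd :
    (facObjIso ℓ Y).inv.left ≫ pullback.snd ((Over.pullback T.hom).obj Y).hom ℓ.left = pullback.snd Y.hom G.hom :=
  Over.w (facObjIso ℓ Y).inv

end OverFac

section PullbackFunctor

set_option backward.isDefEq.respectTransparency false

variable {Z Z' : Scheme.{u}} (f : Z' ⟶ Z)

/-- The unit constraint of `Over.pullback f` followed by the first projection of `Z ×_Z Z'` is `f`. [cite: GortzWedhorn2020, §(4.7)] -/
theorem ε_pullback_left_fst : (ε (Over.pullback f)).left ≫ pullback.fst (𝟙_ (Over Z)).hom f = f := by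
  rw [Over.ε_pullback_left, IsIso.inv_comp_eq]
  exact (Category.comp_id (pullback.fst (𝟙_ (Over Z)).hom f)).symm.trans pullback.condition

/-- Base change of a morphism, then the first projection. [cite: GortzWedhorn2020, §(4.7)] -/
@[reassoc]
theorem pullback_map_left_fst {R R' : Over Z} (g : R ⟶ R') :
    ((Over.pullback f).map g).left ≫ pullback.fst R'.hom f = pullback.fst R.hom f ≫ g.left := by
  simp only [Over.pullback_map_left, pullback.lift_fst]

/-- The tensor constraint of `Over.pullback f` followed by the first projection is `fst ×_f fst`, read on the first factor.
[cite: GortzWedhorn2020, §(4.7)] -/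
@[reassoc]
theorem μ_pullback_left_fst_fst (R R' : Over Z) :
    (Functor.LaxMonoidal.μ (Over.pullback f) R R').left ≫ pullback.fst (R ⊗ R').hom f ≫ pullback.fst R.hom R'.hom =
      pullback.fst _ _ ≫ pullback.fst R.hom f :=
  Over.μ_pullback_left_fst_fst R R'

/-- The tensor constraint of `Over.pullback f` followed by the first projection, read on the second factor. [cite: GortzWedhorn2020, §(4.7)] -/
@[reassoc]
theorem μ_pullback_left_fst_snd (R R' : Over Z) :
    (Functor.LaxMonoidal.μ (Over.pullback f) R R').left ≫ pullback.fst (R ⊗ R').hom f ≫ pullback.snd R.hom R'.hom =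
      pullback.snd _ _ ≫ pullback.fst R'.hom f :=
  Over.μ_pullback_left_fst_snd R R'

end PullbackFunctor

/-! ## §2 The dock -/

namespace LocApprox

open Literature.AlgebraicGeometry.Motives (SchemeOver specOver)
open Literature.AlgebraicGeometry.Limits.OverFac

set_option backward.isDefEq.respectTransparency false

variable {A : Type u} [CommRing A] [IsDomain A] {K : Type u} [Field K] [Algebra A K] [IsFractionRing A K]
  {P : SchemeOver A} [QuasiCompact P.hom] [QuasiSeparated P.hom] {t : Idx (nonZeroDivisors A)}

/-- **A GROUP LAW ON THE GENERIC FIBRE DESCENDS TO A STAGE, COMPATIBLY** (EGA IV₃ 8.8.2 for group objects over the relative base `P ⊗ D(t)`; the (d)-socket of the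
(SP1-e) assembly `AbelianSchemeOver.exists_stage_of_generic`).  Hypotheses: `A` a domain with fraction field `K`, `P` quasi-compact quasi-separated over `A` with the
stage `P ⊗ D(t) → D(t)` flat; `Y → P ⊗ D(t)` quasi-compact, quasi-separated, locally of finite presentation, flat and separated; `X → P ⊗ Spec K` a group scheme,
base change of `Y` along the leg (`pb`).  Conclusion: a finer stage `ρ : s ⟶ t`, a group law on `Yₛ = Y ×_{P ⊗ D(t)} (P ⊗ D(s))` over `P ⊗ D(s)`, the restriction
`R : Yₛ → Y` (cartesian over the transition) and a cartesian comparison `Gₛ : X → Yₛ` over the leg at `s` with `Gₛ ≫ R = G`, intertwining units and multiplications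
(the clauses of MFK Def. 7.2 ∕ ★ `IsBaseChangeVia`).
[cite: EGAIV3, Thm. 8.8.2] [cite: StacksProject, Tag 01ZM] [cite: MumfordFogartyKirwan1994, Ch. 7 §2 Definition 7.2 (p. 129)] -/
theorem exists_stage_grpObj_isPullback [Flat (pullback.snd P.hom ((baseDiagram (nonZeroDivisors A)).obj t).hom)]
    (X : Over (P ⊗ specOver A K).left) [GrpObj X]
    (Y : Over (P ⊗ (baseDiagram (nonZeroDivisors A)).obj t).left) [QuasiCompact Y.hom] [QuasiSeparated Y.hom]
    [LocallyOfFinitePresentation Y.hom] [Flat Y.hom] [IsSeparated Y.hom]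
    (G : X.left ⟶ Y.left) (pb : IsPullback G X.hom Y.hom (P ◁ leg (nonZeroDivisors A) K t).left) :
    ∃ (s : Idx (nonZeroDivisors A)) (ρ : s ⟶ t) (Yₛ : Over (P ⊗ (baseDiagram (nonZeroDivisors A)).obj s).left) (_ : GrpObj Yₛ)
      (Gₛ : X.left ⟶ Yₛ.left) (R : Yₛ.left ⟶ Y.left) (w : Gₛ ≫ Yₛ.hom = X.hom ≫ (P ◁ leg (nonZeroDivisors A) K s).left),
      IsPullback R Yₛ.hom Y.hom (P ◁ (baseDiagram (nonZeroDivisors A)).map ρ).left ∧ Gₛ ≫ R = G ∧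
        IsPullback Gₛ X.hom Yₛ.hom (P ◁ leg (nonZeroDivisors A) K s).left ∧
          η[X].left ≫ Gₛ = (P ◁ leg (nonZeroDivisors A) K s).left ≫ η[Yₛ].left ∧
            μ[X].left ≫ Gₛ =
              pullback.map X.hom X.hom Yₛ.hom Yₛ.hom Gₛ Gₛ (P ◁ leg (nonZeroDivisors A) K s).left w.symm w.symm ≫ μ[Yₛ].left := by
  -- (0) transport the group structure of `X` to `Y_B = Y ×_{P_t} (P ⊗ Spec K)` along the canonical isomorphism
  let YB : Over (P ⊗ specOver A K).left := (Over.pullback (genOver (nonZeroDivisors A) K P t).hom).obj Y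
  let eX : X ≅ YB := Over.isoMk pb.isoPullback (pb.isoPullback_hom_snd)
  letI : GrpObj YB := GrpObj.ofIso eX
  -- (1) spread the structure maps to a common stage `ρ : s ⟶ t`
  obtain ⟨s, ρ, ⟨d⟩⟩ := exists_grpSpreadAlong K Y
  -- (2) the descended group law on `Yₛ` (fixed-stage transfer: the stage is flat over `D(s)`, the leg is schematically dominant)
  haveI : Flat (pullback.snd P.hom ((baseDiagram (nonZeroDivisors A)).obj s).hom) :=
    MorphismProperty.of_isPullback (SubalgApprox.isPullback_whiskerLeft_left P ((baseDiagram (nonZeroDivisors A)).map ρ)) ‹_›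
  haveI : IsSchemeTheoreticallyDominant (leg (nonZeroDivisors A) K s).left :=
    Literature.NumberTheory.EllipticCurves.isSchemeTheoreticallyDominant_leg_left K s
  haveI : QuasiCompact (relLeg (nonZeroDivisors A) K P ρ).left := quasiCompact_relLeg_left (nonZeroDivisors A) K P ρ
  haveI : IsSchemeTheoreticallyDominant (relLeg (nonZeroDivisors A) K P ρ).left :=
    isSchemeTheoreticallyDominant_relLeg_left (nonZeroDivisors A) K P ρ
  let Yₛ : Over (P ⊗ (baseDiagram (nonZeroDivisors A)).obj s).left := (Over.pullback (stageOver (nonZeroDivisors A) P ρ).hom).obj Y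
  haveI : Flat Yₛ.hom := inferInstanceAs (Flat (pullback.snd Y.hom _))
  haveI : IsSeparated Yₛ.hom := MorphismProperty.of_isPullback (IsPullback.of_hasPullback Y.hom (stageOver (nonZeroDivisors A) P ρ).hom) ‹_›
  letI hYₛ : GrpObj Yₛ := d.grpObj
  have hmon := d.isMonHom_facObjIso_hom
  -- the comparison `X ⟶ (Yₛ)_B`: a homomorphism for the structure INDUCED by base change along the relative leg `ℓ`
  let ℓ := relLeg (nonZeroDivisors A) K P ρ
  letI : MonObj ((Over.pullback ℓ.left).obj Yₛ) := Functor.monObjObj (F := Over.pullback ℓ.left) Yₛ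
  haveI : IsMonHom eX.hom := isMonHom_ofIso eX
  haveI : IsMonHom (OverFac.facObjIso ℓ Y).hom := hmon
  haveI hh : IsMonHom (eX.hom ≫ (OverFac.facObjIso ℓ Y).inv) := inferInstance
  -- the data: `Gₛ := (X ≅ Y_B ≅ (Yₛ)_B) → Yₛ`, `R := Yₛ → Y`
  have w : ((eX.hom ≫ (OverFac.facObjIso ℓ Y).inv).left ≫ pullback.fst Yₛ.hom ℓ.left) ≫ Yₛ.hom =
      X.hom ≫ (P ◁ leg (nonZeroDivisors A) K s).left := by
    rw [Over.comp_left, Category.assoc, Category.assoc, pullback.condition, facObjIso_inv_left_snd_assoc]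
    exact congrArg (· ≫ _) (Over.w eX.hom)
  refine ⟨s, ρ, Yₛ, hYₛ, (eX.hom ≫ (OverFac.facObjIso ℓ Y).inv).left ≫ pullback.fst Yₛ.hom ℓ.left,
    pullback.fst Y.hom (stageOver (nonZeroDivisors A) P ρ).hom, w, IsPullback.of_hasPullback Y.hom (stageOver (nonZeroDivisors A) P ρ).hom,
    ?_, ?_, ?_, ?_⟩
  · -- `Gₛ ≫ R = G`
    rw [Over.comp_left, Category.assoc, Category.assoc, facObjIso_inv_left_fst_fst]
    exact pb.isoPullback_hom_fst
  · -- `Gₛ` is cartesian over the leg at `s`: an isomorphism `X ≅ (Yₛ)_B` followed by the projections of a fibre product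
    refine IsPullback.of_iso_pullback ⟨w⟩ ((Over.forget _).mapIso (eX ≪≫ (OverFac.facObjIso ℓ Y).symm)) rfl ?_
    change (eX.hom ≫ (OverFac.facObjIso ℓ Y).inv).left ≫ pullback.snd Yₛ.hom ℓ.left = X.hom
    rw [Over.comp_left, Category.assoc, facObjIso_inv_left_snd]
    exact Over.w eX.hom
  · -- units: `η[X] ≫ h = η[(Yₛ)_B] = ε ≫ (η[Yₛ])_B`, read on underlying schemes
    have e1 : η[X] ≫ (eX.hom ≫ (OverFac.facObjIso ℓ Y).inv) = ε (Over.pullback ℓ.left) ≫ (Over.pullback ℓ.left).map η[Yₛ] := by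
      rw [IsMonHom.one_hom, Functor.obj.η_def]
    have e2 := congrArg (fun k => CommaMorphism.left k ≫ pullback.fst Yₛ.hom ℓ.left) e1
    simp only [Over.comp_left, Category.assoc] at e2
    rw [pullback_map_left_fst, ← Category.assoc (ε (Over.pullback ℓ.left)).left, ε_pullback_left_fst] at e2
    rw [Over.comp_left, Category.assoc]
    exact e2
  · -- multiplications: `μ[X] ≫ h = (h ⊗ h) ≫ μ[(Yₛ)_B] = (h ⊗ h) ≫ μ_ℓ ≫ (μ[Yₛ])_B`, read on underlying schemes
    have e1 : μ[X] ≫ (eX.hom ≫ (OverFac.facObjIso ℓ Y).inv) =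
        ((eX.hom ≫ (OverFac.facObjIso ℓ Y).inv) ⊗ₘ (eX.hom ≫ (OverFac.facObjIso ℓ Y).inv)) ≫
          Functor.LaxMonoidal.μ (Over.pullback ℓ.left) Yₛ Yₛ ≫ (Over.pullback ℓ.left).map μ[Yₛ] := by
      rw [IsMonHom.mul_hom, Functor.obj.μ_def]
    have e2 := congrArg (fun k => CommaMorphism.left k ≫ pullback.fst Yₛ.hom ℓ.left) e1
    simp only [Over.comp_left, Category.assoc] at e2
    rw [pullback_map_left_fst] at e2
    have key : ((eX.hom ≫ (OverFac.facObjIso ℓ Y).inv) ⊗ₘ (eX.hom ≫ (OverFac.facObjIso ℓ Y).inv)).left ≫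
        (Functor.LaxMonoidal.μ (Over.pullback ℓ.left) Yₛ Yₛ).left ≫ pullback.fst (Yₛ ⊗ Yₛ).hom ℓ.left =
          pullback.map X.hom X.hom Yₛ.hom Yₛ.hom ((eX.hom ≫ (OverFac.facObjIso ℓ Y).inv).left ≫ pullback.fst Yₛ.hom ℓ.left)
            ((eX.hom ≫ (OverFac.facObjIso ℓ Y).inv).left ≫ pullback.fst Yₛ.hom ℓ.left) (P ◁ leg (nonZeroDivisors A) K s).left
            w.symm w.symm := by
      apply pullback.hom_ext
      · rw [pullback.lift_fst, Category.assoc, Category.assoc, μ_pullback_left_fst_fst, Over.tensorHom_left, pullback.lift_fst_assoc,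
          Category.assoc]
      · rw [pullback.lift_snd, Category.assoc, Category.assoc, μ_pullback_left_fst_snd, Over.tensorHom_left, pullback.lift_snd_assoc,
          Category.assoc]
    rw [← reassoc_of% key]
    simpa only [Over.comp_left, Category.assoc] using e2

end LocApprox

end Literature.AlgebraicGeometry.Limits

end
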